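import Summits.BirchSwinnertonDyer.BirchSwinnertonDyer.Theorems.ErratumRoadFiveEulerHalfGenusLabelsOddSupply
import Summits.BirchSwinnertonDyer.BirchSwinnertonDyer.Theorems.ClassRecordThreeCornerAtThreeShimuraWalkFamilyDictionary
import Literature.NumberTheory.EllipticCurves.GrossPointsKolyvaginDerivative
import HarnessLib

/-!
# ErratumRoadFive ∕ EulerHalf ∕ genus line — (b2b-κ) adapter A: the genus divisibility depth `mdiv` IS the family's
# `ShimuraWalk.PDiv` (helper, `--supports 23444`)

Cell bsd-stepL, prover seat `bsd-stepL-imc-p1` g42; plan `HOME/imc-p1/g42/B2BK-ASSEMBLY-PLAN-imc-p1-g42.md` §4 A ∕ §7.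

WHAT.  The class-data child `GenusLine.GenusClassDataSupply` measures divisibility through ALL CM-presented genus data:
`u ≤ mdiv c ↔ ∀ δ : GenusKolyvaginDatum …, ∃ z, p^u • z = genusFamilyPoint … δ`.  The CR3 family class package measures it through
`ShimuraWalk.PDiv hK ι W ys p c u` (ALL presentations `(σ′, H′, f′)` of Kolyvagin's operator on the labelled family `ys`) and, per datum,
`KolyvaginFamilyData.PDiv` (ONE presentation; dictionary `ShimuraWalk.pDiv_iff_familyData_pDiv`, corner3-p2).  This file identifies the
genus currency with the family currency at every GENUINE level `c` (`c ≠ 0`, `c` prime to `N_{E′}`), given the `±` identification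
`Θ_{δ.ϑ}(δ.Q) = ± ys c` of `GenusLine.GenusLabelsSupplyOddAt`:
* `exists_familyData_pDiv_iff_of_genusDatum` — a genus datum `δ` with `Θ(δ) = u • ys c` (`u = ±1`) yields a family datum `d` on `ys`
  with δ's presentation and `d.PDiv p M ↔ ∃ z, p^M • z = genusFamilyPoint δ` for every `M` (`P(δ) = u • P(d)`: `derivedPoint` is additive).
* `exists_genusDatum_of_presentation` — at a genuine level every presentation `(g, T)` is carried by SOME genus datum (point from the
  printed fact (G1), root `θ↑`).
* `forall_genusDatum_pDiv_iff_pDiv` — THE DICTIONARY: below the Gross depth `M` of the level (Kolyvagin hypotheses + the weak (B4) label at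
  `c`, as in `pDiv_iff_familyData_pDiv`), `(∀ δ, ∃ z, p^μ • z = genusFamilyPoint δ) ↔ ShimuraWalk.PDiv hK S.ιc W ys p c μ`.

HONEST FRAMING: bookkeeping between two tree currencies; conditional on the printed fact (G1) where stated; no crux and no stub is
closed; BSD is proved for no curve.  [cite: GrossLMS1991, §3, §4 (4.1), Prop. 3.6] [cite: McCallumLMS1991, §4 (4), §5 (p. 303)]
presearch: in-tree only (`pDiv_iff_familyData_pDiv`, `exists_familyData_y_eq`, Defs III `genusFamilyData_derivedPoint`); no new literature.
-/

set_option autoImplicit false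
-- D-0017: single-problem summit, so `Summit.BirchSwinnertonDyer.BirchSwinnertonDyer.…` repeats a namespace BY DESIGN.
set_option linter.dupNamespace false

noncomputable section

open scoped Classical
open WeierstrassCurve NumberField Literature.NumberTheory.EllipticCurves Literature.NumberTheory.EllipticCurves.ModularForms
  Summit.BirchSwinnertonDyer.Rank1Residual Summit.BirchSwinnertonDyer.Rank1Residual.X11b

namespace Summit.BirchSwinnertonDyer.BirchSwinnertonDyer.Theorems.GenusLine

variable {W A : WeierstrassCurve ℚ} {p q : ℕ} {K : Type} [Field K] [NumberField K]

/-! ## §1 `P(n)` is additive in the point -/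

/-- `Σ_{s ∈ S} s D_n (m • y) = m • Σ_{s ∈ S} s D_n y` (`m ∈ ℤ`). [cite: GrossLMS1991, §4 (4.1)] -/
theorem derivedPoint_zsmul {G : Type*} [Monoid G] {B : Type*} [AddCommGroup B] (ρ : G →* AddMonoid.End B)
    (σ : ℕ → G) (n : ℕ) (S : Finset G) (m : ℤ) (y : B) :
    KolyvaginOperator.derivedPoint ρ σ n S (m • y) = m • KolyvaginOperator.derivedPoint ρ σ n S y := by
  simp only [KolyvaginOperator.derivedPoint, KolyvaginOperator.derivOpProd_zsmul, map_zsmul, Finset.smul_sum]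

/-! ## §2 A genus datum with `Θ(δ) = ± ys c` gives a family datum on `ys` with the same presentation and the same divisibility -/

/-- **From a CM-presented genus datum to a family datum on the labelled family.**  For `δ` at level `c` with
`Θ_{δ.ϑ}(δ.Q) = u • ys c`, `u = ±1`: the family datum `d = (ys c, δ.g, δ.T, e)` has `d.y = ys c` and
`d.PDiv p M ↔ p^M ∣ P(c, δ)` for every `M` (`P(c, δ) = u • P(d)`, `u² = 1`). [cite: GrossLMS1991, §4 (4.1)] [cite: McCallumLMS1991, §5 (p. 303)] -/
theorem exists_familyData_pDiv_iff_of_genusDatum (S : GenusHeegnerSettingRC W A p q K)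
    (ys : (m : ℕ) → (W.baseChange (ringClassField K S.ιc m : Type)).toAffine.Point) {c : ℕ}
    (δ : haveI := S.nz; GenusKolyvaginDatum S.E' K S.ιc S.Dt S.β S.d₁ c)
    (e : ringClassField K S.ιc c →+* AlgebraicClosure K)
    (he : ∀ k : K, e (algebraMap K (ringClassField K S.ιc c) k) = algebraMap K (AlgebraicClosure K) k)
    {u : ℤ} (hu : u = 1 ∨ u = -1)
    (hΘ : haveI := S.nz; haveI := S.nf; genusTransport W S.E' S.D S.C₂ S.hWd K S.ιc δ = u • ys c) :
    haveI := S.nz; haveI := S.nf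
    ∃ d : JET.KolyvaginFamilyData W K S.ιc c, d.y = ys c ∧ d.σ = δ.g ∧ d.S = δ.T ∧ d.emb = e ∧
      ∀ M : ℕ, d.PDiv p M ↔
        ∃ z : (W.baseChange (ringClassField K S.ιc c : Type)).toAffine.Point,
          ((p ^ M : ℕ) : ℤ) • z = genusFamilyPoint W S.E' S.D S.C₂ S.hWd K S.ιc δ := by
  haveI := S.nz; haveI := S.nf
  have hu2 : u * u = 1 := by rcases hu with rfl | rfl <;> norm_num
  refine ⟨⟨ys c, δ.g, δ.hg, δ.T, δ.hT, δ.hT', e, he⟩, rfl, rfl, rfl, rfl, fun M ↦ ?_⟩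
  -- `P(c, δ) = u • P(d)`
  have hP : genusFamilyPoint W S.E' S.D S.C₂ S.hWd K S.ιc δ =
      u • (⟨ys c, δ.g, δ.hg, δ.T, δ.hT, δ.hT', e, he⟩ : JET.KolyvaginFamilyData W K S.ιc c).derivedPoint := by
    rw [← genusFamilyData_derivedPoint δ e he, JET.KolyvaginFamilyData.derivedPoint, JET.KolyvaginFamilyData.derivedPoint,
      genusFamilyData_y, genusFamilyData_σ, genusFamilyData_S, hΘ, derivedPoint_zsmul]
  constructor
  · rintro ⟨Q, hQ⟩
    exact ⟨u • Q, by rw [smul_comm, hQ, hP]⟩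
  · rintro ⟨z, hz⟩
    refine ⟨u • z, ?_⟩
    rw [smul_comm, hz, hP, smul_smul, hu2, one_smul]

/-! ## §3 Every presentation at a genuine level is carried by a genus datum -/

/-- **A genus datum with PRESCRIBED presentation at a genuine level.**  For `c ≠ 0` prime to `N_{E′}`, generators `g` and a transversal
`T` as in `GenusKolyvaginDatum`, the printed fact (G1) (a `K[c]`-rational point of `E′` over the CM point of conductor `c`) and the root
`θ↑ ∈ K[c]` of `d₁` give a datum `δ` with `δ.g = g`, `δ.T = T`. [cite: GrossLMS1991, §3 (x_n ∈ X₀(N)(K_n))] [cite: Voight2007, Prop. 3.8] -/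
theorem exists_genusDatum_of_presentation
    (hG1 : ∀ (N : ℕ) [NeZero N] (W : WeierstrassCurve ℚ) (K : Type) [Field K] [NumberField K],
      phi_heegnerPointOfConductor_mem_range_map_ringClassField_birch N W K)
    (S : GenusHeegnerSettingRC W A p q K) (hK : IsImaginaryQuadratic K) {c : ℕ} (hc : c ≠ 0)
    (hcN : haveI := S.nz; c.Coprime (S.E'.conductorNorm ℤ))
    (g : ℕ → (ringClassField K S.ιc c ≃ₐ[ℚ] ringClassField K S.ιc c))
    (T : Finset (ringClassField K S.ιc c ≃ₐ[ℚ] ringClassField K S.ιc c))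
    (hg : ∀ ℓ ∈ c.primeFactors, Subgroup.zpowers (g ℓ) = ringClassGalOver S.ιc c (c / ℓ))
    (hT : ∀ t ∈ T, t ∈ ringClassGal S.ιc c)
    (hT' : ∀ h ∈ ringClassGal S.ιc c, ∃! t, t ∈ T ∧ h⁻¹ * t ∈ ringClassGalOver S.ιc c 1) :
    haveI := S.nz
    ∃ δ : GenusKolyvaginDatum S.E' K S.ιc S.Dt S.β S.d₁ c, δ.g = g ∧ δ.T = T := by
  haveI := S.nz; haveI := S.ell
  -- the point over the CM point of conductor `c` (printed fact G1)
  obtain ⟨Q, hQ⟩ := hG1 (S.E'.conductorNorm ℤ) S.E' K hK S.Dt S.β S.ιc c S.hβ hc hcN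
  -- the root `θ↑ ∈ K[c]`
  have h1c : ringClassField K S.ιc 1 ≤ ringClassField K S.ιc c := ringClassField_mono hK S.ιc (one_dvd c) hc
  set ϑ : ringClassField K S.ιc c := RingClassField.inclusion S.ιc h1c S.θ with hϑdef
  have hϑ2 : ϑ ^ 2 = algebraMap ℚ (ringClassField K S.ιc c) (S.d₁ : ℚ) := by
    rw [hϑdef, ← map_pow, S.hθ2]
    exact ((RingClassField.inclusion S.ιc h1c).restrictScalars ℚ).commutes (S.d₁ : ℚ)
  have hϑ0 : ϑ ≠ 0 := by
    rw [hϑdef]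
    exact (map_ne_zero_iff _ (RingClassField.inclusion S.ιc h1c).injective).mpr S.hθ0
  exact ⟨⟨Q, hQ, ϑ, hϑ2, hϑ0, g, T, hg, hT, hT'⟩, rfl, rfl⟩

/-! ## §4 The dictionary: genus `mdiv` versus `ShimuraWalk.PDiv` below the Gross depth of the level -/

/-- **THE DICTIONARY** (per genuine level `c`, below its Gross depth `M`): with the `±` identification at `c`
(`GenusLabelsSupplyOddAt`'s second conjunct), the Kolyvagin hypotheses at depth `M ≥ 1` and the weak (B4) label at `c` for `ys`
(the hypotheses of `ShimuraWalk.pDiv_iff_familyData_pDiv`), and `μ ≤ M`: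
`(∀ δ, ∃ z, p^μ • z = P(c, δ)) ↔ ShimuraWalk.PDiv hK S.ιc W ys p c μ`.  (←) every `δ` presents a family datum on `ys` (§2) and
the corner3 dictionary reads `PDiv` at it; (→) carry ANY presentation (`ShimuraWalk.exists_familyData_y_eq`) by a genus datum (§3, printed
fact G1), read the hypothesis at it, and return through the corner3 dictionary («one ⟹ all»).
[cite: GrossLMS1991, §4 (4.1), Prop. 3.6] [cite: McCallumLMS1991, §4 (4), §5 (p. 303)] -/
theorem forall_genusDatum_pDiv_iff_pDiv [W.IsElliptic] [W.IsGloballyMinimal] [Fact p.Prime]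
    (hG1 : ∀ (N : ℕ) [NeZero N] (W : WeierstrassCurve ℚ) (K : Type) [Field K] [NumberField K],
      phi_heegnerPointOfConductor_mem_range_map_ringClassField_birch N W K)
    (S : GenusHeegnerSettingRC W A p q K) (hK : IsImaginaryQuadratic K)
    {N : ℕ} [NeZero N] (Dt : ModularParametrizationData W N) {M : ℕ} (hM : 1 ≤ M)
    {c : ℕ} (hc : Squarefree c) (hcN : haveI := S.nz; c.Coprime (S.E'.conductorNorm ℤ))
    (hkol : ∀ q' ∈ c.primeFactors, IsKolyvaginPrime N W K p q' ∧ FrobEqFrobInfty W K (p ^ M) q')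
    (ys : (m : ℕ) → (W.baseChange (ringClassField K S.ιc m : Type)).toAffine.Point)
    (hB4 : ∀ ℓ ∈ c.primeFactors, ∀ σ : ringClassField K S.ιc c ≃ₐ[ℚ] ringClassField K S.ιc c,
      Subgroup.zpowers σ = ringClassGalOver S.ιc c (c / ℓ) →
      ∃ y' : (W.baseChange (ringClassField K S.ιc c : Type)).toAffine.Point,
        ∑ i ∈ Finset.range (ℓ + 1), pointGalHom W (ringClassField K S.ιc c) (σ ^ i) (ys c) =
          W.frobeniusTrace ℓ • y')
    (hid : haveI := S.nz; haveI := S.nf; ∀ δ : GenusKolyvaginDatum S.E' K S.ιc S.Dt S.β S.d₁ c,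
      genusTransport W S.E' S.D S.C₂ S.hWd K S.ιc δ = ys c ∨ genusTransport W S.E' S.D S.C₂ S.hWd K S.ιc δ = -ys c)
    {μ : ℕ} (hμ : μ ≤ M) :
    haveI := S.nz; haveI := S.nf
    (∀ δ : GenusKolyvaginDatum S.E' K S.ιc S.Dt S.β S.d₁ c,
        ∃ z : (W.baseChange (ringClassField K S.ιc c : Type)).toAffine.Point,
          ((p ^ μ : ℕ) : ℤ) • z = genusFamilyPoint W S.E' S.D S.C₂ S.hWd K S.ιc δ) ↔
      ShimuraWalk.PDiv hK S.ιc W ys p c μ := by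
  haveI := S.nz; haveI := S.nf
  have hp : p.Prime := Fact.out
  have hc0 : c ≠ 0 := hc.ne_zero
  -- the sign at a datum
  have hsign : ∀ δ : GenusKolyvaginDatum S.E' K S.ιc S.Dt S.β S.d₁ c, ∃ u : ℤ, (u = 1 ∨ u = -1) ∧
      genusTransport W S.E' S.D S.C₂ S.hWd K S.ιc δ = u • ys c := fun δ ↦ by
    rcases hid δ with h | h
    · exact ⟨1, Or.inl rfl, by rw [h, one_smul]⟩
    · exact ⟨-1, Or.inr rfl, by rw [h, neg_one_smul]⟩
  -- an embedding `K[c] → K̄` over `K` (any family datum carries one)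
  obtain ⟨d₁, hd₁⟩ := ShimuraWalk.exists_familyData_y_eq (W := W) hK S.ιc hc (fun q' hq' ↦ (hkol q' hq').1.2.2.2.2.1) ys
  constructor
  · -- (→): carry `d₁`'s presentation by a genus datum `δ₀`, read the hypothesis at `δ₀`, return through the corner3 dictionary
    intro hall
    obtain ⟨δ₀, hg, hT⟩ := exists_genusDatum_of_presentation hG1 S hK hc0 hcN d₁.σ d₁.S d₁.zpowers_σ d₁.S_subset d₁.S_transversal
    obtain ⟨u, hu, hΘ⟩ := hsign δ₀
    obtain ⟨d, hdy, -, -, -, hdiv⟩ := exists_familyData_pDiv_iff_of_genusDatum S ys δ₀ d₁.emb d₁.emb_apply hu hΘ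
    exact (ShimuraWalk.pDiv_iff_familyData_pDiv hK S.ιc Dt hp hM hc hkol ys d hdy hB4 hμ).mpr ((hdiv μ).mpr (hall δ₀))
  · -- (←): every `δ` presents a family datum on `ys`
    intro hP δ
    obtain ⟨u, hu, hΘ⟩ := hsign δ
    obtain ⟨d, hdy, -, -, -, hdiv⟩ := exists_familyData_pDiv_iff_of_genusDatum S ys δ d₁.emb d₁.emb_apply hu hΘ
    exact (hdiv μ).mp ((ShimuraWalk.pDiv_iff_familyData_pDiv hK S.ιc Dt hp hM hc hkol ys d hdy hB4 hμ).mp hP)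

end Summit.BirchSwinnertonDyer.BirchSwinnertonDyer.Theorems.GenusLine

end
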